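import Summits.MatrixMultiplication.OmegaCensus.STPPSmallPatternKernelSearch122B

/-!
# ω-census, small STPP pattern `(1,2,2)^k`: second-level chunking — FACTORED cover hypothesis

HONEST FRAMING (pub-omega census; verbatim): lottery ticket; floor = certified bounds/negative ranges.
Census STRUCTURE bookkeeping of the STPP track (seat pub-omega-stpp-3, gen 24; STRUCTURE row B5, column `T2`), not progress on `ω`.

`not_exists_isSTPP_122_of_search2xx_dualP` (`STPPSmallPatternKernelSearch122B.lean`) embeds the second-level chunk list in the
first-level cover hypothesis; for cells with many second-level chunks (e.g. `ℤ/30`, 156 chunks) that statement is too large to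
elaborate.  This file factors it: the starts certified at the second level are a separate list `XX` of pairs `(y, c'₀)`, the chunk
cover of each such start is its own (kernel-decided) hypothesis, and the first-level cover only tests membership in `XX`
(`not_exists_isSTPP_122_of_search2xx_dualX`).

References: H. Cohn, R. Kleinberg, B. Szegedy, C. Umans, FOCS 2005 (arXiv:math/0511460), Def. 5.1.
-/

namespace Summit.MatrixMultiplication.OmegaCensus

namespace STPP122Neg

open STPP211Neg Literature.Computability.AlgebraicComplexity

section Refl

variable {G : Type} [AddCommGroup G] {K : ℕ}

/-- **REFLECTION THROUGH DEF. 5.1 with first- and second-level chunks — FACTORED FORM**: as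
`not_exists_isSTPP_122_of_search2xx_dualP`, with the second-level-certified starts listed in `XX` and their `b₁`-covers a separate
hypothesis. [cite: CohnKleinbergSzegedyUmans2005, Def. 5.1] -/
theorem not_exists_isSTPP_122_of_search2xx_dualX [DecidableEq G] (E : GEnc G) (hK : 2 ≤ K) {chunks : List (ℕ × ℕ)}
    (hsearch : search2x E.g K chunks = true) {chunks3 : List (ℕ × ℕ × ℕ)} (hsearch3 : search2xx E.g K chunks3 = true)
    (XX : List (ℕ × ℕ)) (hxx : ∀ p ∈ XX, ∀ v, v < E.g.n → ∃ e ∈ chunks3, e.1 = p.1 ∧ e.2.1 = p.2 ∧ e.2.2.testBit v = false)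
    {reps : List ℕ} {ι κ : Type*} (mkA : ι → G → G) (IA : List ι)
    (haddA : ∀ i ∈ IA, ∀ a b : G, mkA i (a + b) = mkA i a + mkA i b) (hkerA : ∀ i ∈ IA, ∀ x : G, mkA i x = 0 → x = 0)
    (hcover : ∀ d : G, d ≠ 0 → ∃ i ∈ IA, E.enc (mkA i d) ∈ reps)
    (mkS : κ → G → G) (IS : List κ)
    (haddS : ∀ j ∈ IS, ∀ a b : G, mkS j (a + b) = mkS j a + mkS j b) (hkerS : ∀ j ∈ IS, ∀ x : G, mkS j x = 0 → x = 0)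
    (hchunks : ∀ d : G, E.enc d ∈ reps → ∀ z : G,
      (∃ j ∈ IS, mkS j d = d ∧
        ((∃ e ∈ chunks, e.1 = E.enc d ∧ e.2.testBit (E.enc (mkS j z)) = false) ∨ (E.enc d, E.enc (mkS j z)) ∈ XX)) ∨
      (∃ i ∈ IA, E.enc (mkA i (-z)) ∈ reps ∧ ∃ j ∈ IS, mkS j (mkA i (-z)) = mkA i (-z) ∧
        ((∃ e ∈ chunks, e.1 = E.enc (mkA i (-z)) ∧ e.2.testBit (E.enc (mkS j (mkA i (-d)))) = false) ∨
         (E.enc (mkA i (-z)), E.enc (mkS j (mkA i (-d)))) ∈ XX))) :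
    ¬ ∃ A B C : Fin K → Finset G, IsSTPP A B C ∧ ∀ i, (A i).card = 1 ∧ (B i).card = 2 ∧ (C i).card = 2 := by
  have lift : ∀ y w : ℕ, ((∃ e ∈ chunks, e.1 = y ∧ e.2.testBit w = false) ∨ (y, w) ∈ XX) →
      ((∃ e ∈ chunks, e.1 = y ∧ e.2.testBit w = false) ∨
       (∀ v, v < E.g.n → ∃ e ∈ chunks3, e.1 = y ∧ e.2.1 = w ∧ e.2.2.testBit v = false)) := by
    rintro y w (h | h)
    · exact Or.inl h
    · exact Or.inr fun v hv => hxx (y, w) h v hv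
  refine not_exists_isSTPP_122_of_search2xx_dualP E hK hsearch hsearch3 mkA IA haddA hkerA hcover mkS IS haddS hkerS
    fun d hd z => ?_
  rcases hchunks d hd z with ⟨j, hj, hjd, h⟩ | ⟨i, hi, hid, j, hj, hjd, h⟩
  · exact Or.inl ⟨j, hj, hjd, lift _ _ h⟩
  · exact Or.inr ⟨i, hi, hid, j, hj, hjd, lift _ _ h⟩

end Refl

end STPP122Neg

end Summit.MatrixMultiplication.OmegaCensus
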